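import Mathlib

/-!
# The W-inequality fails for a law with a REQUIRED connection — kernel-checked witness
(blind cell PercRepro2, mine-1 g13; proofs/MINE1-W-BLOCKS.md §2 (N-W1))

The cell's W-inequality (W) for a law `W` on `2^F` is, for all up-sets `U, V`,
`Q_W(1_U, 1_V) = ∑_{s ∩ t = ∅} W_s W_t (1_U(s) − 1_U(t)) (1_V(s) − 1_V(t)) ≥ 0`. It is census-true
for every status law `W_s = P(C(ρ) ∩ F = s)` (n ≤ 7). This file checks in the kernel that it FAILS
for the **required-vertex law** `W_x(s) := P(C(ρ) ∩ F = s, x ∈ C(ρ))` on the graph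
`c5_00005` (edges `04 12 13 24 34`; a 4-cycle `1–2–4–3–1` with a pendant `0` at `4`), root `ρ = 2`,
`F = {0, 1, 4}`, required vertex `x = 3`, all weights `1/2`:

  `32 · W_3 = (∅: 0, {0}: 0, {1}: 2, {0,1}: 0, {4}: 1, {0,4}: 1, {1,4}: 5, {0,1,4}: 5)`,
  and for `U = ↑{4}`, `V = ↑{1}`: `2 · 32² · Q = 0 − 8`, i.e. `Q = −1/256 < 0`.

Requiring `3 ∈ C` forces `1 ∈ C` or `4 ∈ C`, so the masses of `∅` and `{0}` vanish and only the
negative terms of `Q` survive — the «neither» state that carries the positivity of (W) is removed.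
Consequently forgetting a cut vertex from the test set is not a termwise operation for (W):
`Q_coarse = Q_fine + Q_required` with a possibly negative second term (MINE1-W-BLOCKS.md §2).
The masses are established by `decide` (kernel, standard axioms) over the `2^5` configurations.
-/

namespace Summit.Ventures.PercRepro2.WRequiredWitness

/-- The five edges of `c5_00005`. -/
def edge : Nat → Nat × Nat
  | 0 => (0, 4)
  | 1 => (1, 2)
  | 2 => (1, 3)
  | 3 => (2, 4)
  | _ => (3, 4)

/-- Edge `i` is open in the configuration `c ∈ [0, 2^5)` iff bit `i` of `c` is set. -/
def isOpen (c i : Nat) : Bool := c.testBit i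

/-- Vertex sets are bitmasks over `0..4`. -/
def mem (S x : Nat) : Bool := S.testBit x

/-- One expansion step along the open edges. -/
def step (c S : Nat) : Nat :=
  (List.range 5).foldl (fun S i =>
    let e := edge i
    if isOpen c i then
      let S₁ := if mem S e.1 then S ||| (1 <<< e.2) else S
      if mem S₁ e.2 then S₁ ||| (1 <<< e.1) else S₁
    else S) S

/-- `n`-fold iteration of `step c`. -/
def iter (c : Nat) : Nat → Nat → Nat
  | 0, S => S
  | n + 1, S => iter c n (step c S)

/-- The open cluster of the root `2` (five steps suffice on five vertices). -/
def cluster (c : Nat) : Nat := iter c 5 (1 <<< 2)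

/-- The status on `F = {0, 1, 4}` as a 3-bit mask (bit `0 ↦ 0`, bit `1 ↦ 1`, bit `2 ↦ 4`). -/
def status (c : Nat) : Nat :=
  let C := cluster c
  (if mem C 0 then 1 else 0) + (if mem C 1 then 2 else 0) + (if mem C 4 then 4 else 0)

/-- `32 · W_3(S)`: the number of configurations with status `S` and `3` in the cluster
(all weights `1/2`, so every configuration has weight `1/32`). -/
def mass (S : Nat) : Nat :=
  (List.range 32).foldl (fun a c => if mem (cluster c) 3 && status c == S then a + 1 else a) 0

/-- `U = ↑{4}`: the statuses containing `4` (bit `2`). -/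
def inU (S : Nat) : Bool := S.testBit 2
/-- `V = ↑{1}`: the statuses containing `1` (bit `1`). -/
def inV (S : Nat) : Bool := S.testBit 1

/-- The mass table `32 · W_3(S)` for `S = 0, …, 7` (checked against `mass` in `mass_eq_mtab`). -/
def mtab : Nat → Nat
  | 0 => 0
  | 1 => 0
  | 2 => 2
  | 3 => 0
  | 4 => 1
  | 5 => 1
  | 6 => 5
  | _ => 5

/-- The positive part of `2 · 32² · Q_{W_3}(1_U, 1_V)`: disjoint pairs `(s, t)` on which
`(1_U(s) − 1_U(t))(1_V(s) − 1_V(t)) = +1`. -/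
def wpos : Nat :=
  (List.range 64).foldl (fun a k =>
    let s := k / 8
    let t := k % 8
    if s &&& t == 0 && inU s != inU t && inV s != inV t && inU s == inV s then a + mtab s * mtab t
    else a) 0

/-- The negative part: disjoint pairs on which the product of differences is `−1`. -/
def wneg : Nat :=
  (List.range 64).foldl (fun a k =>
    let s := k / 8
    let t := k % 8
    if s &&& t == 0 && inU s != inU t && inV s != inV t && inU s != inV s then a + mtab s * mtab t
    else a) 0

/-- The eight masses agree with the table. -/
theorem mass_eq_mtab : ∀ S, S < 8 → mass S = mtab S := by decide +kernel

/-- `32 · P(3 ∈ C)`: the total required mass. -/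
def reqmass : Nat := (List.range 32).foldl (fun a c => if mem (cluster c) 3 then a + 1 else a) 0

/-- Total required mass `14/32 = P(2 ↔ 3) = 7/16` (sanity: the eight masses sum to it). -/
theorem reqmass_eq : reqmass = 14 := by decide +kernel

/-- No positive term survives (they would need the masses of `∅` or `{0}`). -/
theorem wpos_eq : wpos = 0 := by decide +kernel

/-- The negative terms: the four pairs `({1},{4})`, `({4},{1})`, `({1},{0,4})`, `({0,4},{1})`,
each of mass `2 · 1`. -/
theorem wneg_eq : wneg = 8 := by decide +kernel

/-- **`Q_{W_3}(↑{4}, ↑{1}) = (wpos − wneg) / (2 · 32²) = −1/256 < 0`**: the required-vertex law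
violates the W-inequality. -/
theorem required_law_violates_W :
    ((wpos : ℚ) - wneg) / (2 * 32 ^ 2) = -1 / 256 ∧ ((wpos : ℚ) - wneg) / (2 * 32 ^ 2) < 0 := by
  rw [wpos_eq, wneg_eq]; norm_num

end Summit.Ventures.PercRepro2.WRequiredWitness
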